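import Literature.NumberTheory.Automorphic.HilbertRepIsotypicMultiplicity
import Literature.NumberTheory.Automorphic.HilbertRepDiscretePart
import HarnessLib

/-!
# `K`-type multiplicities: `multiplicity π τ = dim_ℂ Hom_K(τ, π)` for a unitary `π` on any Hilbert space

Topic `NumberTheory/Automorphic`; theorems only (no definition, no named fact, no instance), continuing
`HilbertRepIsotypicMultiplicity` (`multiplicity π τ · dim τ = dim H_τ`) and `CompactGroupIsotypicDimension`
(`dim H_τ = dim τ · dim Hom_G(τ, π)` for FINITE-dimensional `H`), removing the finite-dimensionality of the ambient
space: the representation `π` may live on any Hilbert space, as the `K`-types of an (infinite-dimensional) unitary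
representation restricted to a compact subgroup `K` do.

A. Deitmar, S. Echterhoff, *Principles of Harmonic Analysis* (2nd ed. 2014), §7.3 (printed pp. 142–143 = PDF
pp. 197–199): for a unitary representation `(π, V_π)` of the compact group `K` on a Hilbert space and `τ ∈ K̂`, the
canonical map `T_τ : Hom_K(V_τ, V_π) ⊗ V_τ → V_π`, `α ⊗ v ↦ α(v)`, has image the isotype `V_π(τ)` ("the image of
`T_τ` lies in `V_π(τ)`. Indeed, the image is all of `V_π(τ)`"), and "`V_π(τ)` is unitarily equivalent to a direct
sum of `V_τ`'s with multiplicity `dim Hom_K(V_τ, V_π)`" (p. 143); Lemma 7.3.1: `⟨α, β⟩ = ⟨α(v₀), β(v₀)⟩` is an inner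
product on `Hom_K(V_τ, V_π)` ("as by Corollary 6.1.9, any element of `Hom_K(V_τ, V_π)` is either zero or injective").
T. Bröcker, T. tom Dieck, *Representations of Compact Lie Groups* (1985), II (1.13): "If `W` is irreducible we call
the dimension `dim_ℂ Hom_G(W, V)` the multiplicity of `W` in `V`".

Here `G` is any group for §1–§2 and a compact Hausdorff group for §3; `π` is a unitary representation on a complex
Hilbert space `H`; `τ` is an irreducible unitary representation on a finite-dimensional `E`; `Hom_G(τ, π)` is the
space `Schur.intertwiners τ π` of bounded intertwining operators `E →L[ℂ] H` (`CompactGroups/CharacterMultiplicity`);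
`H_τ = π.isotypicComponent τ`.

* `intertwiner_eq_zero_of_apply_eq_zero`, `injective_intertwiners_apply` — **Schur's lemma, kernel form**
  (Deitmar–Echterhoff Lemma 7.3.1 / Cor. 6.1.9): an intertwiner out of the irreducible `τ` killing a non-zero vector is
  zero, so `T ↦ T w₀` is injective on `Hom_G(τ, π)`;
* `apply_mem_isotypicComponent_of_mem_intertwiners` — **the image of every `G`-map `τ → π` lies in the isotype
  `H_τ`** (its range is an irreducible closed subrepresentation unitarily equivalent to `τ`);
* `nonempty_intertwiners_linearEquiv_isotypicComponent` — `Hom_G(τ, π) ≃ Hom_G(τ, π|_{H_τ})` (corestriction; built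
  inside the proof), hence `finrank_intertwiners_eq_finrank_intertwiners_isotypicComponent`;
* `isotypicComponent_toContRep_eq_top` — `π|_{H_τ}` is its own `τ`-isotype;
* compact `G`: **`finrank_isotypicComponent_eq_finrank_mul_finrank_intertwiners`** — `dim H_τ = dim τ · dim Hom_G(τ, π)`
  whenever `H_τ` is finite-dimensional (`CompactGroupIsotypicDimension` applied to `π|_{H_τ}`);
  **`multiplicity_eq_finrank_intertwiners'`** — `multiplicity π τ = dim_ℂ Hom_G(τ, π)` (`H_τ` finite-dimensional;
  the primed name: the finite-dimensional-`H` version is `multiplicity_eq_finrank_intertwiners` of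
  `HilbertRepIsotypicMultiplicity`); `finiteDimensional_intertwiners_iff` — `Hom_G(τ, π)` is finite-dimensional iff `H_τ`
  is (any `G`); **`multiplicity_eq_top_iff_not_finiteDimensional_intertwiners`** — `multiplicity π τ = ⊤` iff `Hom_G(τ, π)`
  is infinite-dimensional; `multiplicity_eq_finrank_intertwiners_or` — the two cases together.

## References
* A. Deitmar, S. Echterhoff, *Principles of Harmonic Analysis*, 2nd ed. (2014), §7.3 pp. 142–143, Lemma 7.3.1,
  Thm. 7.3.2, Cor. 6.1.9 [DeitmarEchterhoff2014].
* T. Bröcker, T. tom Dieck, *Representations of Compact Lie Groups*, GTM 98 (1985), II (1.13)–(1.14), PDF pp. 69–70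
  [BrockerTomDieck1985].

## Provenance
Lane `lit-hodgefound` (HOME `run/shared/lean/pub/lit-hodgefound/`), prover seat `lit-hodgefound-p05` generation 7 (Layer 0:
`K`-type multiplicities beneath the compact-group / theta-correspondence statements).
-/

noncomputable section

open scoped InnerProductSpace
open Topology Literature.RepresentationTheory.CompactGroups

namespace Literature.NumberTheory.Automorphic

/-! ### §1 Schur's lemma, kernel form -/

section Kernel

variable {G : Type*} [Group G]
variable {E H : Type*} [NormedAddCommGroup E] [InnerProductSpace ℂ E] [NormedAddCommGroup H] [InnerProductSpace ℂ H]
variable {τ : ContRepresentation ℂ G E} {π : ContRepresentation ℂ G H}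

/-- **An intertwiner out of an irreducible representation that kills a non-zero vector is zero** — its kernel is a
non-zero invariant subspace (Deitmar–Echterhoff Lemma 7.3.1: "any element of `Hom_K(V_τ, V_π)` is either zero or
injective", Cor. 6.1.9). [cite: DeitmarEchterhoff2014, Lemma 7.3.1] -/
theorem intertwiner_eq_zero_of_apply_eq_zero [τ.toRepresentation.IsIrreducible] {T : E →L[ℂ] H}
    (hT : T ∈ Schur.intertwiners τ π) {w₀ : E} (hw₀ : w₀ ≠ 0) (h0 : T w₀ = 0) : T = 0 := by
  let N : Subrepresentation τ.toRepresentation :=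
    { toSubmodule := LinearMap.ker (T : E →ₗ[ℂ] H)
      apply_mem_toSubmodule := fun g v hv => by
        rw [LinearMap.mem_ker, ContinuousLinearMap.coe_coe] at hv ⊢
        change T (τ g v) = 0
        have h := congrArg (fun S : E →L[ℂ] H => S v) (hT g)
        simp only [ContinuousLinearMap.comp_apply] at h
        rw [← h, hv, map_zero] }
  rcases IsSimpleOrder.eq_bot_or_eq_top N with hN | hN
  · exfalso
    have hmem : w₀ ∈ N.toSubmodule := by
      rw [LinearMap.mem_ker, ContinuousLinearMap.coe_coe]
      exact h0
    rw [hN] at hmem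
    exact hw₀ ((Submodule.mem_bot ℂ).mp hmem)
  · ext v
    have hv : v ∈ N.toSubmodule := by rw [hN]; trivial
    rw [LinearMap.mem_ker, ContinuousLinearMap.coe_coe] at hv
    rw [hv]
    rfl

/-- Hence **`T ↦ T w₀` is injective on `Hom_G(τ, π)`** for `w₀ ≠ 0` (the inner product
`⟨α, β⟩ = ⟨α(v₀), β(v₀)⟩` of Deitmar–Echterhoff Lemma 7.3.1 is definite). [cite: DeitmarEchterhoff2014, Lemma 7.3.1] -/
theorem injective_intertwiners_apply [τ.toRepresentation.IsIrreducible] {w₀ : E} (hw₀ : w₀ ≠ 0) :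
    Function.Injective fun T : Schur.intertwiners τ π => (T : E →L[ℂ] H) w₀ := by
  intro T T' h
  apply Subtype.ext
  have hsub : ((T : E →L[ℂ] H) - (T' : E →L[ℂ] H)) w₀ = 0 := by
    show (T : E →L[ℂ] H) w₀ - (T' : E →L[ℂ] H) w₀ = 0
    exact sub_eq_zero.mpr h
  exact sub_eq_zero.mp
    (intertwiner_eq_zero_of_apply_eq_zero ((Schur.intertwiners τ π).sub_mem T.2 T'.2) hw₀ hsub)

/-- A non-zero intertwiner out of an irreducible representation is injective. [cite: DeitmarEchterhoff2014, Lemma 7.3.1] -/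
theorem injective_of_mem_intertwiners [τ.toRepresentation.IsIrreducible] {T : E →L[ℂ] H}
    (hT : T ∈ Schur.intertwiners τ π) (hT0 : T ≠ 0) : Function.Injective T := by
  refine (injective_iff_map_eq_zero T).mpr fun v hv => ?_
  by_contra hv0
  exact hT0 (intertwiner_eq_zero_of_apply_eq_zero hT hv0 hv)

end Kernel

/-! ### §2 Intertwiners land in the isotype -/

section Isotype

variable {G : Type*} [Group G]
variable {H : Type*} [NormedAddCommGroup H] [InnerProductSpace ℂ H] [CompleteSpace H]
variable {E : Type*} [NormedAddCommGroup E] [InnerProductSpace ℂ E] [FiniteDimensional ℂ E]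
variable {π : ContRepresentation ℂ G H} {τ : ContRepresentation ℂ G E}

/-- **The range of a non-zero `G`-map `τ → π` out of an irreducible unitary finite-dimensional `τ` is an irreducible
closed subrepresentation of `π` unitarily equivalent to `τ`** (injective by Schur; the algebraic equivalence onto the
range is normalised to a unitary one by `areUnitarilyEquivalent_toContRep_of_equiv`, Deitmar–Echterhoff Cor. 6.1.9).
[cite: DeitmarEchterhoff2014, §7.3] -/
theorem exists_closedSubrep_of_mem_intertwiners (hπu : π.IsUnitary) [τ.toRepresentation.IsIrreducible]
    (hτu : ∀ (g : G) (v w : E), ⟪τ g v, τ g w⟫_ℂ = ⟪v, w⟫_ℂ) {T : E →L[ℂ] H}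
    (hT : T ∈ Schur.intertwiners τ π) (hT0 : T ≠ 0) :
    ∃ W : ContRepresentation.ClosedSubrep π, W.toSubmodule = LinearMap.range (T : E →ₗ[ℂ] H) ∧
      W.toContRep.IsTopIrreducible ∧ ContRepresentation.AreUnitarilyEquivalent W.toContRep τ := by
  have hinj : Function.Injective (T : E →ₗ[ℂ] H) := injective_of_mem_intertwiners hT hT0
  -- the range is a closed invariant subspace
  have hinv : ∀ (g : G), ∀ v ∈ LinearMap.range (T : E →ₗ[ℂ] H), π g v ∈ LinearMap.range (T : E →ₗ[ℂ] H) := by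
    rintro g _ ⟨v, rfl⟩
    refine ⟨τ g v, ?_⟩
    have h := congrArg (fun S : E →L[ℂ] H => S v) (hT g)
    simp only [ContinuousLinearMap.comp_apply] at h
    exact h.symm
  let W : ContRepresentation.ClosedSubrep π := ContRepresentation.ClosedSubrep.ofSubmodule
    (LinearMap.range (T : E →ₗ[ℂ] H)) (Submodule.closed_of_finiteDimensional _) hinv
  -- `τ ≃ W` algebraically, via `T`
  let eₗ : E ≃ₗ[ℂ] W.toSubmodule := LinearEquiv.ofInjective (T : E →ₗ[ℂ] H) hinj
  have heₗ : ∀ v : E, ((eₗ v : W.toSubmodule) : H) = T v := fun v => LinearEquiv.ofInjective_apply (T : E →ₗ[ℂ] H) v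
  let e : τ.toRepresentation.Equiv W.toContRep.toRepresentation :=
    Representation.Equiv.mk eₗ fun g => by
      refine LinearMap.ext fun v => Subtype.ext ?_
      change ((eₗ (τ g v) : W.toSubmodule) : H) = π g ((eₗ v : W.toSubmodule) : H)
      rw [heₗ, heₗ]
      have h := congrArg (fun S : E →L[ℂ] H => S v) (hT g)
      simp only [ContinuousLinearMap.comp_apply] at h
      exact h.symm
  have hequiv : ContRepresentation.AreUnitarilyEquivalent W.toContRep τ :=
    areUnitarilyEquivalent_toContRep_of_equiv hπu W hτu e
  obtain ⟨e', -⟩ := id hequiv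
  have hirr : W.toContRep.IsTopIrreducible :=
    (ContRepresentation.isTopIrreducible_congr e').mpr (isTopIrreducible_of_isIrreducible τ)
  exact ⟨W, rfl, hirr, hequiv⟩

/-- **Every `G`-map `τ → π` takes values in the isotype `H_τ`** (Deitmar–Echterhoff §7.3: "the image of `T_τ` lies in
`V_π(τ)`"). [cite: DeitmarEchterhoff2014, §7.3] -/
theorem apply_mem_isotypicComponent_of_mem_intertwiners (hπu : π.IsUnitary) [τ.toRepresentation.IsIrreducible]
    (hτu : ∀ (g : G) (v w : E), ⟪τ g v, τ g w⟫_ℂ = ⟪v, w⟫_ℂ) {T : E →L[ℂ] H}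
    (hT : T ∈ Schur.intertwiners τ π) (v : E) : T v ∈ π.isotypicComponent τ := by
  by_cases hT0 : T = 0
  · rw [hT0]
    exact (π.isotypicComponent τ).toSubmodule.zero_mem
  · obtain ⟨W, hW, hirr, hequiv⟩ := exists_closedSubrep_of_mem_intertwiners hπu hτu hT hT0
    have hle : W ≤ π.isotypicComponent τ := ContRepresentation.le_isotypicComponent hirr hequiv
    refine hle ?_
    rw [← ContRepresentation.ClosedSubrep.mem_toSubmodule, hW]
    exact ⟨v, rfl⟩

/-- **`Hom_G(τ, π) ≃ Hom_G(τ, π|_{H_τ})`** by corestriction (every `G`-map `τ → π` lands in `H_τ`); the linear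
equivalence is built inside the proof. [cite: DeitmarEchterhoff2014, §7.3] -/
theorem nonempty_intertwiners_linearEquiv_isotypicComponent (hπu : π.IsUnitary) [τ.toRepresentation.IsIrreducible]
    (hτu : ∀ (g : G) (v w : E), ⟪τ g v, τ g w⟫_ℂ = ⟪v, w⟫_ℂ) :
    Nonempty (Schur.intertwiners τ π ≃ₗ[ℂ] Schur.intertwiners τ (π.isotypicComponent τ).toContRep) := by
  set N := π.isotypicComponent τ with hN
  -- corestriction and its inverse
  let cod : Schur.intertwiners τ π → Schur.intertwiners τ N.toContRep := fun T =>
    ⟨(T : E →L[ℂ] H).codRestrict N.toSubmodule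
        (fun v => apply_mem_isotypicComponent_of_mem_intertwiners hπu hτu T.2 v),
      fun g => ContinuousLinearMap.ext fun v => Subtype.ext (by
        have h := congrArg (fun S : E →L[ℂ] H => S v) (T.2 g)
        simp only [ContinuousLinearMap.comp_apply] at h
        exact h)⟩
  let extd : Schur.intertwiners τ N.toContRep → Schur.intertwiners τ π := fun S =>
    ⟨N.toSubmodule.subtypeL.comp (S : E →L[ℂ] N.toSubmodule),
      fun g => ContinuousLinearMap.ext fun v => (by
        have h := congrArg (fun S' : E →L[ℂ] N.toSubmodule => ((S' v : N.toSubmodule) : H)) (S.2 g)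
        simp only [ContinuousLinearMap.comp_apply, ContRepresentation.ClosedSubrep.coe_toContRep_apply] at h
        simp only [ContinuousLinearMap.comp_apply, Submodule.subtypeL_apply]
        exact h)⟩
  let e : Schur.intertwiners τ π ≃ₗ[ℂ] Schur.intertwiners τ N.toContRep :=
    { toFun := cod
      map_add' := fun _ _ => rfl
      map_smul' := fun _ _ => rfl
      invFun := extd
      left_inv := fun T => Subtype.ext (ContinuousLinearMap.ext fun v => rfl)
      right_inv := fun S => Subtype.ext (ContinuousLinearMap.ext fun v => Subtype.ext rfl) }
  exact ⟨e⟩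

/-- Hence `dim Hom_G(τ, π) = dim Hom_G(τ, π|_{H_τ})`. [cite: DeitmarEchterhoff2014, §7.3] -/
theorem finrank_intertwiners_eq_finrank_intertwiners_isotypicComponent (hπu : π.IsUnitary)
    [τ.toRepresentation.IsIrreducible] (hτu : ∀ (g : G) (v w : E), ⟪τ g v, τ g w⟫_ℂ = ⟪v, w⟫_ℂ) :
    Module.finrank ℂ (Schur.intertwiners τ π) =
      Module.finrank ℂ (Schur.intertwiners τ (π.isotypicComponent τ).toContRep) := by
  obtain ⟨e⟩ := nonempty_intertwiners_linearEquiv_isotypicComponent hπu hτu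
  exact e.finrank_eq

/-- **`π|_{H_τ}` is its own `τ`-isotype**: every member `W ≃ τ` of the class, being inside `H_τ`, restricts to a
member of the class for `π|_{H_τ}` (`ClosedSubrep.restrictLE`), and these exhaust `H_τ` (Deitmar–Echterhoff
Thm. 7.3.2 (b)). [cite: DeitmarEchterhoff2014, Thm. 7.3.2] -/
theorem le_isotypicComponent_toContRep_of_mem (hπu : π.IsUnitary) [τ.toRepresentation.IsIrreducible]
    [FiniteDimensional ℂ (π.isotypicComponent τ).toSubmodule] (v : (π.isotypicComponent τ).toSubmodule) :
    v ∈ (π.isotypicComponent τ).toContRep.isotypicComponent τ := by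
  haveI : Nontrivial E := IsSimpleModule.nontrivial (MonoidAlgebra ℂ G) τ.toRepresentation.asModule
  obtain ⟨s, -, hs, -, hsup⟩ := hπu.exists_isotypicMembers_iSup_eq (τ := τ)
  -- each member `W ∈ s` restricts to a member of the class for `π|_{H_τ}`
  have hle : ∀ W ∈ s, W.toSubmodule ≤
      ((π.isotypicComponent τ).toContRep.isotypicComponent τ).toSubmodule.map
        (π.isotypicComponent τ).toSubmodule.subtype := by
    intro W hW w hw
    have hWN : W ≤ π.isotypicComponent τ := ContRepresentation.le_isotypicComponent (hs W hW).1 (hs W hW).2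
    have hirr := (π.isotypicComponent τ).isTopIrreducible_restrictLE hWN (hs W hW).1
    have heq := ((π.isotypicComponent τ).areUnitarilyEquivalent_restrictLE hWN).trans (hs W hW).2
    have hle' := ContRepresentation.le_isotypicComponent hirr heq
    exact ⟨⟨w, hWN hw⟩, hle' (((π.isotypicComponent τ).mem_restrictLE_iff W).mpr hw), rfl⟩
  have hv : (v : H) ∈ (⨆ W ∈ s, W.toSubmodule : Submodule ℂ H) := by
    rw [hsup]
    exact v.2
  obtain ⟨x, hx, hxv⟩ := (iSup₂_le hle) hv
  have hx' : x = v := Subtype.ext hxv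
  exact hx' ▸ hx

/-- … so the `τ`-isotype of `π|_{H_τ}` is everything. [cite: DeitmarEchterhoff2014, Thm. 7.3.2] -/
theorem isotypicComponent_toContRep_eq_top (hπu : π.IsUnitary) [τ.toRepresentation.IsIrreducible]
    [FiniteDimensional ℂ (π.isotypicComponent τ).toSubmodule] :
    ((π.isotypicComponent τ).toContRep.isotypicComponent τ).toSubmodule = ⊤ :=
  Submodule.eq_top_iff'.mpr fun v => le_isotypicComponent_toContRep_of_mem hπu v

/-- If `H_τ` is infinite-dimensional then so is `Hom_G(τ, π)`: the `k` pairwise orthogonal copies of `τ` inside `H_τ`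
(`exists_isotypicMembers_of_not_finiteDimensional`) give `k` linearly independent intertwiners, for every `k`.
[cite: DeitmarEchterhoff2014, Thm. 7.3.2] -/
theorem not_finiteDimensional_intertwiners (hπu : π.IsUnitary) [τ.toRepresentation.IsIrreducible]
    (h : ¬ FiniteDimensional ℂ (π.isotypicComponent τ).toSubmodule) :
    ¬ FiniteDimensional ℂ (Schur.intertwiners τ π) := by
  classical
  haveI : Nontrivial E := IsSimpleModule.nontrivial (MonoidAlgebra ℂ G) τ.toRepresentation.asModule
  obtain ⟨v₀, hv₀⟩ := exists_ne (0 : E)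
  intro hfin
  -- `k = dim Hom + 1` orthogonal members
  obtain ⟨s, hcard, hs, ho⟩ := hπu.exists_isotypicMembers_of_not_finiteDimensional h
    (Module.finrank ℂ (Schur.intertwiners τ π) + 1)
  -- an intertwiner onto each member
  have hT : ∀ W ∈ s, ∃ T : Schur.intertwiners τ π,
      (∀ v, (T : E →L[ℂ] H) v ∈ W) ∧ (T : E →L[ℂ] H) v₀ ≠ 0 := by
    intro W hW
    obtain ⟨e, -⟩ := (hs W hW).2
    -- `e : W.toContRep ≃ τ`; take `T = ι_W ∘ e⁻¹`
    refine ⟨⟨W.toSubmodule.subtypeL.comp e.symm.toContinuousLinearEquiv.toContinuousLinearMap, fun g =>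
      ContinuousLinearMap.ext fun v => ?_⟩, fun v => (e.symm.toContinuousLinearEquiv v).2, fun h0 => ?_⟩
    · have h := congrArg (fun f : E →L[ℂ] W.toSubmodule => (f v : H)) (e.symm.isIntertwining g)
      simp only [ContinuousLinearMap.coe_comp, Function.comp_apply,
        ContRepresentation.ClosedSubrep.coe_toContRep_apply] at h
      simp only [ContinuousLinearMap.comp_apply, Submodule.subtypeL_apply]
      exact h.symm
    · have h1 : e.symm.toContinuousLinearEquiv v₀ = 0 := by
        apply Subtype.ext
        rw [Submodule.coe_zero]
        exact h0
      exact hv₀ (e.symm.toContinuousLinearEquiv.map_eq_zero_iff.mp h1)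
  choose! T hTmem hTne using hT
  -- the `T W`, `W ∈ s`, are linearly independent: their values at `v₀` are non-zero and pairwise orthogonal
  have hli : LinearIndependent ℂ fun W : s => T W := by
    have horth : Pairwise fun W W' : s => ⟪(T W : E →L[ℂ] H) v₀, (T W' : E →L[ℂ] H) v₀⟫_ℂ = 0 := by
      intro W W' hne
      have hWW' : (W : ContRepresentation.ClosedSubrep π) ≠ W' := fun h => hne (Subtype.ext h)
      exact (ho W.2 W'.2 hWW').inner_eq (hTmem W W.2 v₀) (hTmem W' W'.2 v₀)
    have hli' : LinearIndependent ℂ fun W : s => (T W : E →L[ℂ] H) v₀ :=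
      linearIndependent_of_ne_zero_of_inner_eq_zero (fun W => hTne W W.2) horth
    -- a linear relation among the `T W` evaluates at `v₀`
    refine LinearIndependent.of_comp
      ((ContinuousLinearMap.apply ℂ H v₀ : (E →L[ℂ] H) →L[ℂ] H).toLinearMap ∘ₗ (Schur.intertwiners τ π).subtype) ?_
    exact hli'
  have hcard' := hli.fintype_card_le_finrank
  rw [Fintype.card_coe, hcard] at hcard'
  exact absurd hcard' (Nat.not_succ_le_self _)

/-- **`Hom_G(τ, π)` is finite-dimensional iff the isotype `H_τ` is.** [cite: DeitmarEchterhoff2014, Thm. 7.3.2] -/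
theorem finiteDimensional_intertwiners_iff (hπu : π.IsUnitary) [τ.toRepresentation.IsIrreducible]
    (hτu : ∀ (g : G) (v w : E), ⟪τ g v, τ g w⟫_ℂ = ⟪v, w⟫_ℂ) :
    FiniteDimensional ℂ (Schur.intertwiners τ π) ↔ FiniteDimensional ℂ (π.isotypicComponent τ).toSubmodule := by
  constructor
  · intro hfin
    by_contra h
    exact not_finiteDimensional_intertwiners hπu h hfin
  · intro hfin
    obtain ⟨e⟩ := nonempty_intertwiners_linearEquiv_isotypicComponent hπu hτu
    haveI : FiniteDimensional ℂ (E →L[ℂ] (π.isotypicComponent τ).toSubmodule) := inferInstance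
    exact LinearEquiv.finiteDimensional e.symm

end Isotype

/-! ### §3 Compact groups: `multiplicity π τ = dim Hom_G(τ, π)` on any Hilbert space -/

section Compact

variable {G : Type*} [TopologicalSpace G] [Group G] [IsTopologicalGroup G] [CompactSpace G] [T2Space G]
variable {H : Type*} [NormedAddCommGroup H] [InnerProductSpace ℂ H] [CompleteSpace H]
variable {E : Type*} [NormedAddCommGroup E] [InnerProductSpace ℂ E] [FiniteDimensional ℂ E]
variable {π : ContRepresentation ℂ G H} {τ : ContRepresentation ℂ G E}

/-- **`dim H_τ = dim τ · dim_ℂ Hom_G(τ, π)` for a unitary strongly continuous representation of a compact group on ANY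
Hilbert space** with finite-dimensional `τ`-isotype (Deitmar–Echterhoff §7.3, p. 143: "`V_π(τ)` is unitarily
equivalent to a direct sum of `V_τ`'s with multiplicity `dim Hom_K(V_τ, V_π)`"; Bröcker–tom Dieck II (1.14)): the
finite-dimensional statement `finrank_isotypicComponent_eq_mul_finrank_intertwiners` applied to `π|_{H_τ}`, whose
`τ`-isotype is everything and whose `Hom_G(τ, ·)` is that of `π`. [cite: DeitmarEchterhoff2014, Thm. 7.3.2]
[cite: BrockerTomDieck1985, II Prop (1.14)] -/
theorem finrank_isotypicComponent_eq_finrank_mul_finrank_intertwiners (hπc : π.IsStronglyContinuous)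
    (hπu : π.IsUnitary) (hτ : Continuous (τ : G → E →L[ℂ] E)) [τ.toRepresentation.IsIrreducible]
    (hτu : ∀ (g : G) (v w : E), ⟪τ g v, τ g w⟫_ℂ = ⟪v, w⟫_ℂ)
    [FiniteDimensional ℂ (π.isotypicComponent τ).toSubmodule] :
    Module.finrank ℂ (π.isotypicComponent τ).toSubmodule =
      Module.finrank ℂ E * Module.finrank ℂ (Schur.intertwiners τ π) := by
  borelize G
  set N := π.isotypicComponent τ with hN
  have hρc : N.toContRep.IsStronglyContinuous := isStronglyContinuous_toContRep_of_isStronglyContinuous hπc N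
  have hρu : N.toContRep.IsUnitary := hπu.toContRep N
  have h := finrank_isotypicComponent_eq_mul_finrank_intertwiners (π := N.toContRep) hρc hρu hτ hτu
  rw [isotypicComponent_toContRep_eq_top hπu, finrank_top,
    ← finrank_intertwiners_eq_finrank_intertwiners_isotypicComponent hπu hτu] at h
  exact h

/-- **`multiplicity π τ = dim_ℂ Hom_G(τ, π)`** (Bröcker–tom Dieck II (1.13): "we call the dimension `dim_ℂ Hom_G(W, V)`
the multiplicity of `W` in `V`") for a unitary strongly continuous representation `π` of a compact Hausdorff group on
any Hilbert space and an irreducible unitary `τ` with finite-dimensional isotype: the multiplicity of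
`HilbertRepSpectrum` (number of orthogonal copies of `τ`) is the dimension of the space of bounded intertwiners
`τ → π`. [cite: BrockerTomDieck1985, II Prop (1.14)] [cite: DeitmarEchterhoff2014, Thm. 7.3.2] -/
theorem multiplicity_eq_finrank_intertwiners' (hπc : π.IsStronglyContinuous) (hπu : π.IsUnitary)
    (hτ : Continuous (τ : G → E →L[ℂ] E)) [τ.toRepresentation.IsIrreducible]
    (hτu : ∀ (g : G) (v w : E), ⟪τ g v, τ g w⟫_ℂ = ⟪v, w⟫_ℂ)
    [FiniteDimensional ℂ (π.isotypicComponent τ).toSubmodule] :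
    π.multiplicity τ = (Module.finrank ℂ (Schur.intertwiners τ π) : ℕ∞) := by
  haveI : Nontrivial E := IsSimpleModule.nontrivial (MonoidAlgebra ℂ G) τ.toRepresentation.asModule
  rw [hπu.multiplicity_eq_finrank_div,
    finrank_isotypicComponent_eq_finrank_mul_finrank_intertwiners hπc hπu hτ hτu,
    Nat.mul_div_cancel_left _ Module.finrank_pos]

omit [TopologicalSpace G] [IsTopologicalGroup G] [CompactSpace G] [T2Space G] in
/-- **`multiplicity π τ = ⊤` iff `Hom_G(τ, π)` is infinite-dimensional** (any group `G`).
[cite: DeitmarEchterhoff2014, Thm. 7.3.2] -/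
theorem multiplicity_eq_top_iff_not_finiteDimensional_intertwiners (hπu : π.IsUnitary)
    [τ.toRepresentation.IsIrreducible] (hτu : ∀ (g : G) (v w : E), ⟪τ g v, τ g w⟫_ℂ = ⟪v, w⟫_ℂ) :
    π.multiplicity τ = ⊤ ↔ ¬ FiniteDimensional ℂ (Schur.intertwiners τ π) := by
  haveI : Nontrivial E := IsSimpleModule.nontrivial (MonoidAlgebra ℂ G) τ.toRepresentation.asModule
  rw [finiteDimensional_intertwiners_iff hπu hτu, ← hπu.multiplicity_lt_top_iff_finiteDimensional (τ := τ),
    lt_top_iff_ne_top, not_not]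

/-- **The multiplicity as a dimension, unconditionally**: `multiplicity π τ = dim_ℂ Hom_G(τ, π)` in `ℕ∞`, reading an
infinite-dimensional `Hom_G(τ, π)` as `⊤` (`Module.finrank = 0` there, so the statement is phrased with the
finite-dimensionality alternative). [cite: BrockerTomDieck1985, II Prop (1.14)] [cite: DeitmarEchterhoff2014, Thm. 7.3.2] -/
theorem multiplicity_eq_finrank_intertwiners_or (hπc : π.IsStronglyContinuous) (hπu : π.IsUnitary)
    (hτ : Continuous (τ : G → E →L[ℂ] E)) [τ.toRepresentation.IsIrreducible]
    (hτu : ∀ (g : G) (v w : E), ⟪τ g v, τ g w⟫_ℂ = ⟪v, w⟫_ℂ) :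
    (FiniteDimensional ℂ (Schur.intertwiners τ π) ∧
        π.multiplicity τ = (Module.finrank ℂ (Schur.intertwiners τ π) : ℕ∞)) ∨
      (¬ FiniteDimensional ℂ (Schur.intertwiners τ π) ∧ π.multiplicity τ = ⊤) := by
  by_cases hfin : FiniteDimensional ℂ (Schur.intertwiners τ π)
  · left
    haveI := (finiteDimensional_intertwiners_iff hπu hτu).mp hfin
    exact ⟨hfin, multiplicity_eq_finrank_intertwiners' hπc hπu hτ hτu⟩
  · right
    exact ⟨hfin, (multiplicity_eq_top_iff_not_finiteDimensional_intertwiners hπu hτu).mpr hfin⟩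

end Compact

end Literature.NumberTheory.Automorphic

end
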